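import Summits.QuantumFields.YangMills.Theorems.BalabanLadderIRPinnedExitCofinal
import Summits.QuantumFields.YangMills.Theorems.BalabanLadderIRRankPurityCofinalDefs
import Summits.QuantumFields.YangMills.Theorems.BalabanLadderIRTwistCostOfPurity
import Summits.QuantumFields.YangMills.Theorems.BalabanLadderIRAfOnsetCovariance
import Summits.QuantumFields.YangMills.Theses.BalabanLadder
import Summits.QuantumFields.YangMills.Theorems.IR.RunningLandmarkDefs
import Summits.QuantumFields.YangMills.Theorems.BalabanLadderIRcofRunningLandmarkPin
import HarnessLib

/-!
# Crux `IRcof` (stmt-QuantumFields-26930) — LINE `running-landmark` (ideator ym-ir-idea-24 g0, lens `recomb2` = recombination-sharpened)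
# `PXcof(1∕24) ⇐ (EP) PureWithinLandmark(1∕24) ∧ (J) PinnedThaw ⇐ [(RW) RunningWindow ∧ (H) HyperscalingEnvelope ∧ the floor] ∧ (CF)`, then the slot's bill

TOKEN ASSEMBLY (D-0146) onto the slot of record rev 2 `Cruxes/IRcof/Lines/pinned_cofinal_bill.lean` {PXcof(1∕24), N_cof}: this file
concludes `Summit.QuantumFields.YangMills.Theses.BalabanLadder.IRcof` LITERALLY (`IRcof_of_stubs`) through the LANDED X-free cofinal kernel
`PinnedExitCofinal.cofinalGapOn_of_pinnedExits` (p616292) and N_cof = `RankPurity.IRnscCof` BY NAME.  No `skeleton check` is run on the slot.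

THE RECOMBINATION (parents are THEOREMS in tree; cruxes new).  The floor pin of THE NUMBER («`a(β)·L ≤ T`») is moved OUT of the purity
statement and INTO a junction lemma between two theorem families:
* parent family A — LATTICE ASYMPTOTIC FREEDOM AT FIXED LAG ∕ FIXED UNIT (PROVED): `AfOnset.exists_abs_torusCov_dens_le` (p-afpincer, volume-uniform
  `|Cov| ≤ W(1+log β)²∕β²`), `AfOnset.exists_abs_Q2_le_log_sq`, `NTUnitNormalForm.unit_pow_eight_le_of_lowerBounds` (the floor forces
  `a(β)⁸ ≤ K(1+log β)²∕(εβ²)`), `AfOnset`'s half-space flatness lemmas (`BalabanLadderIRAfOnsetHalfSpace`), and the DirichletWindow theorem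
  `Summit.QuantumFields.YangMills.Theorems.localGaussianity_proof` (fixed lag `n`, `β → ∞`: `β² Cov_β(A₀, A_{n e₀}) → (D∕2) c′ₙ²`);
* parent family B — 't HOOFT TWISTS OF THE COLD BOX (PROVED): `TwistCost.twistedPartition_le` (`0 < Z^{(z)} ≤ Z`, twist domination, lit-4
  p611125 + idea-9 S1 p613382), `TwistCost.half_twist_cost_le_coldDefect` (S1: purity ⇒ every central temporal twist is cheap), and the
  classical twisted rate of the femto box (`TwistedSectorClassicalRate`, sharp slab rate p657536) which normalises the twist ratio as a
  finite-volume running coupling («twisted coupling», de Divitiis et al. 1994; 't Hooft 1979 §5);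
* THE ONE NEW JUNCTION LEMMA (J) `pin_of_window : RunningWindow → HyperscalingEnvelope → PinnedThaw` — «the floor `LowerBounds G r a` sits at a
  lag where the twisted running coupling is NOT small»: at every large `β` some cold box of half-side `ℓ ≤ R∕a(β)` is `η⋆`-THAWED (a nontrivial
  central temporal twist costs at most the fraction `1 − η⋆`).  Mechanism (line card §J): split `Q2(θv, v) ≥ ε` into the annulus
  `δ′ ≤ a|y−x| ≤ R` (if frozen there, RW bounds it by `K φ(η⋆) ‖v‖₁² δ′⁻⁸ < ε∕4`, `φ(η) = 1∕log²(1∕η)`), the far pairs (H: `≤ C‖v‖₁²∕R⁸`), and the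
  near-hyperplane pairs (H + order-`M` flatness of `v` at `{u₀ = 0}`: `≤ C δ′^{M−3}`, the flatness beating the `a⁻⁴` of the lattice sum) —
  contradiction unless the annulus is NOT frozen, i.e. a thaw at `ℓ ≤ R∕a(β)`.  Schwartz bookkeeping over parent family A's lemma kit; NO
  Yang–Mills content; stated here as a stub with its exact signature (L-sized), to be landed `--supports` the crux.

THE CUT.  PXcof(1∕24) ⇐ (EP) ∧ (J) ∧ (CF) (`pxcof_of`, PROVED, 8 lines):
* **(EP) `PureWithinLandmark (1/24)`** — FLOOR-FREE, UNIT-FREE, SCHWARTZ-FREE purity: for s.c. compact simple `G` with a nontrivial central twist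
  and every `r`: for EVERY thaw level `η ∈ (0,1)` there is `T(η)` such that at cofinally many couplings some `1∕24`-pure cold `4:1` box has
  half-side `L ≤ T(η)·ℓ` for every `η`-thawed half-side `ℓ` (equivalently `L ≤ T(η)·ℓ_η(β)`, `ℓ_η` the FIRST `η`-thaw).  Each instance
  `(β, L, ℓ)` is ONE inequality between Haar integrals (decidable in principle, MC-locatable: E2-Q3's `r₁` rows READ `ℓ_η`).  Content: the
  purity scale in units of a PERTURBATIVE landmark is bounded along a cofinal coupling set = asymptotic scaling of the purity∕deconfinement
  scale in a finite-volume scheme (the ALPHA-collaboration statement «`L_max ∕ L_{u₀} < ∞`», here with purity for `L_max`).  Width: honest 0 —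
  it carries (C)+(G) of row 42 AND the promptness, but in ONE currency and with no floor; `thawedAt_of_pure` (S1) makes it self-consistent.
* **(RW) `RunningWindow`** — UV∕perturbative-window content (Bałaban∕MRS class, NOT the floor): while every nontrivial central twist of every
  cold box of half-side `≤ n` is `η₁`-frozen, the action-density covariance at lags `n ≤ |y−x| ≤ 2n` on every large torus obeys
  `|Cov| · n⁸ ≤ K ∕ log²(twistRatio(β, z, n))` for some nontrivial central `z` — tree level: both sides are `≍ ḡ⁴(n)∕n⁸`; its fixed-lag,
  `β → ∞` germ is `localGaussianity_proof` ⊕ the classical twisted rate (parents A ⊕ B).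
* **(H) `HyperscalingEnvelope`** — the soft non-perturbative envelope `|Cov_β(x, x+w)| · ‖w‖⁸ ≤ C` for all `w ≠ 0`, `β ≥ β₀`, large tori
  (no decay, no rate; false only on an IR-conformal window with `Δ_{F²} < 4`; rung `hyperscaling_rung_bddSep` PROVED from parent A at bounded
  separations).
* **(CF) `PinnedExitsCofinalCentreFreeAt (1/24)`** — PXcof VERBATIM on the centre-free s.c. simple groups (`G₂, F₄, E₈`) = row 42's declared
  residual token (same decl shape); the twist landmark has no purchase there.
* **N_cof** `RankPurity.IRnscCof` BY NAME.

DISPROOF USED.  `IRcof_false_without_LowerBounds` ∕ `IRnscCof_false_without_LowerBounds` (p630186): the floor is consumed exactly once, in (J)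
(`PinnedThaw` has `LowerBounds G r a` as hypothesis; EP∕RW∕H are floor-free by design).  `HeavyTwist.not_pinnedExitsCofinalFree` (p624174, slow
unit `1∕√β`): EP is NOT `PinnedExitsCofinalFree` — it pins to the twist landmark, not to a free unit; at the slow unit the floor fails and (J)
is not invoked.  `not_uniformExit24_holds` (p621160): no box-before-coupling quantifier anywhere.  Light-flux negatives (p605461): `U(1)`, `SO(3)`
excluded by the binders (simple, simply-connected).

HONEST FRAMING.  Nothing here proves the Yang–Mills mass gap (Clay), `IRcof`, `IR`, PXcof, or any leg; (EP) carries the infrared content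
(confinement + gap + asymptotic scaling in one currency), (RW) is constructive-UV content, (J) is bookkeeping, LANDED as `pin_of_window` (rev 3); R2c stays
IDEA-BOUND; nothing continuum ∕ OS ∕ Clay.  R4 closes only the conditional finite-𝕋⁴ rung `BalabanLadder.UV`.

REV 2 (2026-08-28, after VERDICT-running-landmark-idea24-crit3-g3 = PASS-WITH-PRICE row 48, KEY = ONE helper (J); LEAD ab-p1 hygiene «re-cut to import, cite BY
NAME, delete in-file copies»): §0–§1 now IMPORT `Summits.QuantumFields.YangMills.Theorems.IR.RunningLandmarkDefs` (pool-p3 g15, p666269 — this file's rev-1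
vocabulary and tokens landed verbatim in the same namespace); stubs and compositions unchanged (6 sorries = the six `stub_*`); `stub_pin` is literally the
statement of the row-48 helper `pin_of_window : RunningWindow → HyperscalingEnvelope → PinnedThaw` (part 2, pool-p3) and closes BY NAME when it lands.
READING NOTE (bus 21:02:39Z): the tree's twisted partition function is 't Hooft's TEMPORAL twist (time = the short axis), so `twistRatio` is the ELECTRIC
ratio `r_k` of the thermal box `ℓ³ × ⌊ℓ∕4⌋` at `T = 4∕(aℓ)` (eng-2's E2-Q3 observable); `ℓ_η` is the femto landmark for `η` below the small-volume bump and
`≈ L_conf` above it (interface-frozen deconfined window in between); (EP), (RW), (H), (J) unchanged as typed.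
REV 3 (2026-08-28, ym-ir-idea-24 g2; crit-3 g4 GO bus l.1341): (J) DISCHARGED — the file now imports
`Summits.QuantumFields.YangMills.Theorems.BalabanLadderIRcofRunningLandmarkPin` and `stub_pin := pin_of_window` (p668713); sorries 6 → 5 = (RW) `stub_runningWindow`,
(H) `stub_hyperscaling`, (EP) `stub_pureWithinLandmark`, (CF) `stub_pxcofCentreFree`, N_cof `stub_irnscCof`.  All statements and compositions unchanged; HONEST
label unchanged (nothing here proves Clay ∕ `IRcof` ∕ `IR` ∕ PXcof; (EP) is the infrared content and is OPEN).
-/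

set_option autoImplicit false

noncomputable section

open Filter Topology MeasureTheory
open scoped SchwartzMap
open Literature.MathematicalPhysics.QuantumFieldTheory Literature.MathematicalPhysics.QuantumLattice
open Literature.Probability.LatticeModels (Site)
open Summit.QuantumFields.YangMills.Cruxes.OSLegsFromFemtoAndGap.DlrCollarTransfer (LowerBounds torusE dens Q2)
open Summit.QuantumFields.YangMills.Cruxes.IR.ColdPurityBridge (coldDefect)
open Summit.QuantumFields.YangMills.Cruxes.IR.RankPurity (IRnscCof)
open Summit.QuantumFields.YangMills.Cruxes.IR.PinnedExitCofinal (cofinalGapOn_of_pinnedExits)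
open Summit.QuantumFields.YangMills.Cruxes.IR.TwistCost (twistedPartition_le half_twist_cost_le_coldDefect)

namespace Summit.QuantumFields.YangMills.Cruxes.IRcof.RunningLandmark

/-! ## §0–§1 LANDED (rev 2): the vocabulary (`IsCentralTwist`, `twistRatio`, `ThawedAt`, `FrozenBelow`, monotonicity, `twistRatio_pos ∕ _le_one`,
`thawedAt_of_pure`, `centre_trivial_of_no_twist`), the torus covariance (`torusCov`, `Q2_eq_sum_torusCov`) and the statements of the cut
(`PinnedExitsCofinalAt`, `PureWithinLandmark`, `RunningWindow`, `HyperscalingEnvelope`, `PinnedThaw`, `PinnedExitsCofinalCentreFreeAt`) are now the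
Theorems module `Summits.QuantumFields.YangMills.Theorems.IR.RunningLandmarkDefs` (pool-p3 g15, p666269; same namespace, verbatim texts) and are
IMPORTED BY NAME — the in-file copies of rev 1 (4ce0ec1369f2) are deleted, so the stubs below are literally the landed declarations' statements and
(J) `stub_pin` IS CLOSED BY NAME (rev 3) by `pin_of_window : RunningWindow → HyperscalingEnvelope → PinnedThaw` (part 2 of the row-48 helper, p668713). -/

/-! ## §2 Stubs (sorries ONLY here) -/

/-- **stub (RW)** — asymptotic freedom on the frozen window, twisted-coupling form (UV content). -/
theorem stub_runningWindow : RunningWindow := by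
  sorry

/-- **stub (H)** — the hyperscaling envelope of the action-density covariance (soft, non-perturbative, no decay claimed). -/
theorem stub_hyperscaling : HyperscalingEnvelope := by
  sorry

/-- **(J) = the junction lemma, CLOSED BY NAME (rev 3)** — (RW) ∧ (H) ∧ floor ⇒ a thaw within `R` floor-units: this is literally the landed
theorem `pin_of_window` (`Theorems/BalabanLadderIRcofRunningLandmarkPin.lean`, pool-p3 g15, p668713 ACCEPTED; kit p667765; crit-3 g4 TYPEREAD CLEAN,
axioms standard).  Kept under its stub name so the compositions below are unchanged; it is no longer a sorry. -/
theorem stub_pin : RunningWindow → HyperscalingEnvelope → PinnedThaw :=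
  pin_of_window

/-- **stub (EP)** — `1∕24`-purity within `T(η)` twist landmarks at cofinally many couplings (THE infrared content of the line). -/
theorem stub_pureWithinLandmark : PureWithinLandmark (1 / 24) := by
  sorry

/-- **stub (CF)** — PXcof(1∕24) on the centre-free class (declared residual, row 42's token verbatim). -/
theorem stub_pxcofCentreFree : PinnedExitsCofinalCentreFreeAt (1 / 24) := by
  sorry

/-- **stub N_cof** — the NECESSARY `π₁(G) ≠ 1` conjunct of the leaf BY NAME (`RankPurity.IRnscCof`). -/
theorem stub_irnscCof : IRnscCof := by
  sorry

/-! ## §3 Compositions (PROVED, stub-free) -/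

/-- **PXcof(θ) ⇐ (EP)(θ) ∧ (J) ∧ (CF)(θ).**  With a nontrivial central twist: (J) gives, at every `β ≥ β₀`, an `η`-thawed half-side `ℓ` with
`a(β)·ℓ ≤ R`; (EP) at that `η` gives cofinally a `θ`-pure box with `L ≤ T·ℓ`; hence `a(β)·L ≤ max T 0 · R`.  Centre-free: (CF) verbatim. -/
theorem pxcof_of {θ : ℝ} (hEP : PureWithinLandmark θ) (hJ : PinnedThaw) (hCF : PinnedExitsCofinalCentreFreeAt θ) :
    PinnedExitsCofinalAt θ := by
  intro G _ _ _ _ hG hsc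
  letI : MeasurableSpace G := borel G
  haveI : BorelSpace G := ⟨rfl⟩
  intro r a ha ha0 hlb
  by_cases hz : ∃ z : Fin 4 → G, IsCentralTwist z
  · obtain ⟨η, R, β₀, hη0, hη1, hpin⟩ := hJ G hG hsc hz r a ha ha0 hlb
    obtain ⟨T, hT⟩ := hEP G hG hsc hz r η hη0 hη1
    refine ⟨max T 0 * R, fun β₁ => ?_⟩
    obtain ⟨β, hβ, L, hL, hδ, hland⟩ := hT (max β₁ β₀)
    obtain ⟨ℓ, hth, hℓR⟩ := hpin β ((le_max_right _ _).trans hβ)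
    refine ⟨β, (le_max_left _ _).trans hβ, L, hL, ?_, hδ⟩
    have hLℓ : (L : ℝ) ≤ T * ℓ := hland ℓ hth
    have hℓ0 : (0 : ℝ) ≤ (ℓ : ℝ) := Nat.cast_nonneg ℓ
    have haℓ : 0 ≤ a β * (ℓ : ℝ) := mul_nonneg (ha β).le hℓ0
    have hR0 : 0 ≤ R := haℓ.trans hℓR
    calc a β * (L : ℝ) ≤ a β * (max T 0 * ℓ) := by
            refine mul_le_mul_of_nonneg_left (hLℓ.trans ?_) (ha β).le
            exact mul_le_mul_of_nonneg_right (le_max_left _ _) hℓ0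
      _ = max T 0 * (a β * ℓ) := by ring
      _ ≤ max T 0 * R := mul_le_mul_of_nonneg_left hℓR (le_max_right _ _)
  · exact hCF G hG hsc (centre_trivial_of_no_twist hz) r a ha ha0 hlb

/-- The bill as ONE proposition (behind a `def`, so that `IRcof_of_stubs` is the file's only crux-headed theorem). -/
def Bill : Prop :=
  RunningWindow → HyperscalingEnvelope → (RunningWindow → HyperscalingEnvelope → PinnedThaw) →
    PureWithinLandmark (1 / 24) → PinnedExitsCofinalCentreFreeAt (1 / 24) → IRnscCof →
      Summit.QuantumFields.YangMills.Theses.BalabanLadder.IRcof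

/-- **The bill holds** (PROVED composition): s.c. `G` — `pxcof_of` then the landed X-free cofinal kernel `cofinalGapOn_of_pinnedExits`;
`π₁(G) ≠ 1` — N_cof verbatim. -/
theorem IRcof_of : Bill := by
  intro hRW hH hJ hEP hCF hN G _ _ _ _ hG
  letI : MeasurableSpace G := borel G
  haveI : BorelSpace G := ⟨rfl⟩
  intro r a ha ha0 hlb
  by_cases hsc : SimplyConnectedSpace G
  · obtain ⟨T, hcof⟩ := pxcof_of hEP (hJ hRW hH) hCF G hG hsc r a ha ha0 hlb
    exact cofinalGapOn_of_pinnedExits r a ha ha0 hcof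
  · exact hN G hG hsc r a ha ha0 hlb

/-- **`IRcof` (the route's decl, literally) from the registered stubs.** -/
theorem IRcof_of_stubs : Summit.QuantumFields.YangMills.Theses.BalabanLadder.IRcof :=
  IRcof_of stub_runningWindow stub_hyperscaling stub_pin stub_pureWithinLandmark stub_pxcofCentreFree stub_irnscCof

/-- The PXcof token alone, from the line's stubs (for the census: what this line prices PXcof(1∕24) at). -/
theorem pxcof24_of_stubs : PinnedExitsCofinalAt (1 / 24) :=
  pxcof_of stub_pureWithinLandmark (stub_pin stub_runningWindow stub_hyperscaling) stub_pxcofCentreFree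

/-! ## §4 Rungs (PROVED): the bounded-separation envelope from parent family A; thaw is forced by purity (S1) -/

section Rungs

variable {G : Type} [Group G] [TopologicalSpace G] [IsTopologicalGroup G] [CompactSpace G]
  [MeasurableSpace G] [BorelSpace G]

/-- **(H) at bounded separation is a THEOREM** (parent A, `AfOnset.exists_abs_torusCov_dens_le`): for every `ρ₀` there is `C` with
`|Cov_β(A_x, A_{x+w})| · ‖w‖⁸ ≤ C` for all `‖w‖ ≤ ρ₀`, `β ≥ 1`, every odd torus `2S+1 ≥ 3`.  (H)'s content is the uniformity in `w`.) -/
theorem hyperscaling_rung_bddSep (r : LatticeRep G) (ρ₀ : ℝ) :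
    ∃ C : ℝ, ∀ β : ℝ, 1 ≤ β → ∀ S : ℕ, 1 ≤ S → ∀ x w : Site 4, ‖siteToE w‖ ≤ ρ₀ →
      |torusCov G r β S x (x + w)| * ‖siteToE w‖ ^ 8 ≤ C := by
  obtain ⟨W, hW0, hW⟩ := Summit.QuantumFields.YangMills.Cruxes.IR.AfOnset.exists_abs_torusCov_dens_le (G := G) (r := r)
  refine ⟨W * (max ρ₀ 0) ^ 8, fun β hβ S hS x w hw => ?_⟩
  have hcov : |torusCov G r β S x (x + w)| ≤ W * (1 + Real.log β) ^ 2 / β ^ 2 := hW S hS β hβ x (x + w)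
  have hlog : (1 + Real.log β) ^ 2 / β ^ 2 ≤ 1 := by
    have hβ0 : 0 < β := by linarith
    have h1 : 1 + Real.log β ≤ β := by
      have := Real.add_one_le_exp (Real.log β)
      rw [Real.exp_log hβ0] at this
      linarith
    have h0 : 0 ≤ 1 + Real.log β := by have := Real.log_nonneg hβ; linarith
    rw [div_le_one (by positivity)]
    exact pow_le_pow_left₀ h0 h1 2
  have hn0 : 0 ≤ ‖siteToE w‖ := norm_nonneg _
  have hn : ‖siteToE w‖ ^ 8 ≤ (max ρ₀ 0) ^ 8 := pow_le_pow_left₀ hn0 (hw.trans (le_max_left _ _)) 8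
  calc |torusCov G r β S x (x + w)| * ‖siteToE w‖ ^ 8
      ≤ (W * (1 + Real.log β) ^ 2 / β ^ 2) * (max ρ₀ 0) ^ 8 :=
        mul_le_mul hcov hn (pow_nonneg hn0 8) (by positivity)
    _ ≤ W * 1 * (max ρ₀ 0) ^ 8 := by
        rw [mul_div_assoc]
        exact mul_le_mul_of_nonneg_right (mul_le_mul_of_nonneg_left hlog hW0) (by positivity)
    _ = W * (max ρ₀ 0) ^ 8 := by ring

end Rungs

end Summit.QuantumFields.YangMills.Cruxes.IRcof.RunningLandmark

end
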